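import Literature.Computability.Cryptography.LeftoverHashLemma
import Literature.Computability.Cryptography.LiuPassCondEPPRG
import HarnessLib

/-!
# Inaccessible entropy ⇒ UOWHF: hashing inputs, hashing outputs, random shifts (Haitner–Holenstein–Reingold–Vadhan–Wee 2020, Lemmas 5.4–5.6), combinatorial core

Topic `Literature/Computability/Cryptography`; third file of the "one-way functions ⇒ universal one-way
hash functions" line (Rompel 1990 = Goldreich 2004, Thm. 6.4.29, via HHRVW, *Inaccessible Entropy II*,
Theory of Computing 16(8), 2020; plan in `InaccessibleEntropyPrefixHash.lean`). Single input length, finite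
counting, explicit constants; hash families are abstract `h : κ → δ → γ` with the tree's
`LeftoverHash.IsPairwiseIndep` (`LeftoverHashLemma.lean`) and the analogous `IsThreewiseIndep` (here):

* `IsThreewiseIndep`, `IsThreewiseIndep.card_collide_two` (double collisions have probability `1/|γ|²`).
* **Lemma 5.4 (i)** (input hashing keeps real min-entropy), for `F'(a,k) = (F a, k, h_k a)`: with
  `sameHash F h a k` the fibre elements other than `a` sharing `a`'s hash value (so the `F'`-fibre of
  `(a,k)` has `1 + |sameHash|` elements), the first and second moments over the key
  (`sum_card_sameHash_mul`, `sum_card_sameHash_sq_mul`) and the Chebyshev count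
  `card_sameHash_small_mul_le`: `#{k : 2|γ| · |sameHash(a,k)| ≤ N−1} · (N−1) ≤ 4|γ||κ|` for `N = |F⁻¹(F a)|`.
  DEVIATION, recorded: the printed proof of 5.4 (i) fixes the hash function and bounds a conditional
  probability by a quotient of probabilities, which silently assumes `Pr[F(X)=F(x) ∧ g(X)=z] ≥
  Pr[F(X)=F(x)] · Pr[g(X)=z]` for a FIXED `g`; this fails in general. The statement survives on average over
  the key for a three-wise independent family (which the constructible families are) by the second-moment
  argument proved here; the resulting parameters are at least as good (`k − ℓ − 1` bits except with
  probability `4 · 2^ℓ/(N−1)`).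
* **Lemma 5.4 (ii)** (input hashing turns small accessible sets into collision resistance on random inputs):
  the union bound `card_exists_collide_mul_le` (designated collisions inside candidate sets `T a`, Eq. (5.4))
  and the reduction count `card_move_le_card_escape_add` (an `F'`-finder that moves either escapes `L` or
  exhibits a designated collision inside `L`, Eq. (5.2)–(5.5)).
* **Lemma 5.5** (output hashing makes the function shrinking while keeping collision resistance):
  `card_image_mul_le` (few images under real min-entropy, Eq. (5.6)), `card_exists_image_collide_mul_le`
  (Eq. (5.7)) and the reduction count `card_move_le_card_collision_add`.
* **Lemma 5.6** (random shift, folklore): `card_shift_collision_eq` — over an additive group, the collision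
  finder `x ↦ (x − x₀) + A(x − x₀)` succeeds on exactly as many `(x, ρ, r)` as the two-stage target-collision
  adversary `(x₀(ρ), A(·, ρ; r))` does on `(y, ρ, r)` against `F_y(x) = F(y + x)`.

All statements are proved; no named facts. Lemma 5.7 (input-length extension) and the assembly of
Theorem 5.1 (Steps 1–5, machines, asymptotics) are separate files.

## References

* I. Haitner, T. Holenstein, O. Reingold, S. Vadhan, H. Wee, *Inaccessible Entropy II: IE Functions and
  Universal One-Way Hashing*, Theory of Computing 16(8) (2020) 1–55: §2.4, Lemma 3.7, Lemmas 5.4, 5.5, 5.6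
  and their proofs (pp. 27–30).
* S. Arora, B. Barak, *Computational Complexity: A Modern Approach*, CUP 2009, Def. 8.14 (pairwise independent
  families; through `LeftoverHashLemma.lean`).
* M. Naor, M. Yung, *Universal one-way hash functions and their cryptographic applications*, STOC 1989
  (target collision resistance; the random-shift folklore).
-/

namespace Literature.Computability.Cryptography

namespace HHRVW

open Finset Real LeftoverHash

variable {α β κ γ : Type*}

/-! ### Three-wise independence -/

section ThreeWise

variable [DecidableEq γ] [Fintype γ]

/-- **Three-wise independence** of a finite family `(h_k)_{k ∈ K}` on a set `S`: for pairwise distinct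
`x, x', x'' ∈ S` and all `y, y', y''`, exactly `|K|/|γ|³` keys send `(x, x', x'') ↦ (y, y', y'')` (stated
multiplied out). [cite: HaitnerEtAl2020, §2.4 (t-wise independent families)] -/
def IsThreewiseIndep (K : Finset κ) (h : κ → α → γ) (S : Finset α) : Prop :=
  ∀ x ∈ S, ∀ x' ∈ S, ∀ x'' ∈ S, x ≠ x' → x ≠ x'' → x' ≠ x'' → ∀ y y' y'' : γ,
    (K.filter fun k => h k x = y ∧ h k x' = y' ∧ h k x'' = y'').card * Fintype.card γ ^ 3 = K.card

/-- Three-wise independence gives the double collision probability `1/|γ|²` for three distinct points: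
`#{k : h_k x' = h_k x ∧ h_k x'' = h_k x} · |γ|² = |K|`. [cite: HaitnerEtAl2020, §2.4 and Eq. (4.11)] -/
theorem IsThreewiseIndep.card_collide_two {K : Finset κ} {h : κ → α → γ} {S : Finset α}
    (hK : IsThreewiseIndep K h S) {x x' x'' : α} (hx : x ∈ S) (hx' : x' ∈ S) (hx'' : x'' ∈ S)
    (h1 : x ≠ x') (h2 : x ≠ x'') (h3 : x' ≠ x'') :
    (K.filter fun k => h k x' = h k x ∧ h k x'' = h k x).card * Fintype.card γ ^ 2 = K.card := by
  classical
  rcases isEmpty_or_nonempty γ with hγ | hγ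
  · have hKc : K.card = 0 := by
      by_contra hne0
      obtain ⟨k, hk⟩ := Finset.card_pos.1 (Nat.pos_of_ne_zero hne0)
      exact hγ.elim (h k x)
    simp [hKc, Fintype.card_eq_zero]
  -- decompose along the common value `y = h_k x`
  have hdecomp : (K.filter fun k => h k x' = h k x ∧ h k x'' = h k x).card =
      ∑ y : γ, (K.filter fun k => h k x = y ∧ h k x' = y ∧ h k x'' = y).card := by
    rw [Finset.card_eq_sum_card_fiberwise (f := fun k => h k x) (t := Finset.univ) (fun _ _ => Finset.mem_univ _)]
    refine Finset.sum_congr rfl fun y _ => ?_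
    congr 1
    ext k
    simp only [Finset.mem_filter]
    constructor
    · rintro ⟨⟨hk, he', he''⟩, hy⟩; exact ⟨hk, hy, he'.trans hy, he''.trans hy⟩
    · rintro ⟨hk, hy, hy', hy''⟩; exact ⟨⟨hk, hy'.trans hy.symm, hy''.trans hy.symm⟩, hy⟩
  have hy : ∀ y : γ, (K.filter fun k => h k x = y ∧ h k x' = y ∧ h k x'' = y).card * Fintype.card γ ^ 3 = K.card :=
    fun y => hK x hx x' hx' x'' hx'' h1 h2 h3 y y y
  have hsum : (∑ y : γ, (K.filter fun k => h k x = y ∧ h k x' = y ∧ h k x'' = y).card) * Fintype.card γ ^ 3 =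
      Fintype.card γ * K.card := by
    rw [Finset.sum_mul, Finset.sum_congr rfl fun y _ => hy y, Finset.sum_const, Finset.card_univ, smul_eq_mul]
  rw [hdecomp]
  have hγpos : 0 < Fintype.card γ := Fintype.card_pos
  have h3' : (∑ y : γ, (K.filter fun k => h k x = y ∧ h k x' = y ∧ h k x'' = y).card) * Fintype.card γ ^ 2 *
      Fintype.card γ = K.card * Fintype.card γ := by
    rw [mul_assoc, ← pow_succ, hsum, mul_comm]
  exact Nat.eq_of_mul_eq_mul_right hγpos h3'

end ThreeWise

/-! ### Lemma 5.4 (i): hashing the input keeps real min-entropy (second moment under three-wise independence) -/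

section HashInputReal

variable [Fintype α] [DecidableEq α] [DecidableEq β] [Fintype κ] [DecidableEq γ] [Fintype γ]

/-- The same-hash part of the fibre: `C(x, k) = #{x' : F x' = F x ∧ h_k x' = h_k x}` — the first
components of the fibre of `F'(x, k) = (F x, k, h_k x)`; we count it without `x` itself,
`Y(x, k) = C(x, k) − 1`. [cite: HaitnerEtAl2020, Lemma 5.4 (the function `F'`)] -/
def sameHash (F : α → β) (h : κ → α → γ) (x : α) (k : κ) : Finset α :=
  ((fiber univ F (F x)).erase x).filter fun x' => h k x' = h k x

/-- First moment: `Σ_k Y(x,k) · |γ| = (|F⁻¹(F x)| − 1) · |κ|` (pairwise independence on the fibre).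
[cite: HaitnerEtAl2020, Lemma 5.4 (ii) (proof, "pairwise independence … linearity of expectation")] -/
theorem sum_card_sameHash_mul (F : α → β) {h : κ → α → γ} (x : α)
    (hK : IsPairwiseIndep (univ : Finset κ) h (fiber univ F (F x))) :
    (∑ k, (sameHash F h x k).card) * Fintype.card γ = ((fiber univ F (F x)).card - 1) * Fintype.card κ := by
  classical
  have hswap : ∑ k, (sameHash F h x k).card =
      ∑ x' ∈ (fiber univ F (F x)).erase x, ((univ : Finset κ).filter fun k => h k x' = h k x).card := by
    simp only [sameHash, Finset.card_filter]
    exact Finset.sum_comm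
  rw [hswap, Finset.sum_mul]
  have hx : x ∈ fiber univ F (F x) := mem_fiber.2 ⟨Finset.mem_univ _, rfl⟩
  have hterm : ∀ x' ∈ (fiber univ F (F x)).erase x,
      ((univ : Finset κ).filter fun k => h k x' = h k x).card * Fintype.card γ = Fintype.card κ := by
    intro x' hx'
    rw [Finset.mem_erase] at hx'
    have := hK.card_collide hx'.2 hx hx'.1
    rwa [Finset.card_univ] at this
  rw [Finset.sum_congr rfl hterm, Finset.sum_const, smul_eq_mul, Finset.card_erase_of_mem hx]

/-- Second moment: `Σ_k Y(x,k)² · |γ|² = (N−1) |κ| |γ| + (N−1)(N−2) |κ|` for `N = |F⁻¹(F x)|`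
(three-wise independence on the fibre: the diagonal by pairwise, the off-diagonal pairs by three-wise
independence). [cite: HaitnerEtAl2020, Lemma 5.4 (i) with §2.4] -/
theorem sum_card_sameHash_sq_mul (F : α → β) {h : κ → α → γ} (x : α)
    (hK2 : IsPairwiseIndep (univ : Finset κ) h (fiber univ F (F x)))
    (hK3 : IsThreewiseIndep (univ : Finset κ) h (fiber univ F (F x))) :
    (∑ k, (sameHash F h x k).card ^ 2) * Fintype.card γ ^ 2 =
      ((fiber univ F (F x)).card - 1) * Fintype.card κ * Fintype.card γ +
        ((fiber univ F (F x)).card - 1) * ((fiber univ F (F x)).card - 2) * Fintype.card κ := by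
  classical
  set S := (fiber univ F (F x)).erase x with hS
  have hx : x ∈ fiber univ F (F x) := mem_fiber.2 ⟨Finset.mem_univ _, rfl⟩
  have hScard : S.card = (fiber univ F (F x)).card - 1 := Finset.card_erase_of_mem hx
  -- expand the square as a double sum over `S × S` and exchange with the sum over keys
  have hsq : ∀ k, (sameHash F h x k).card ^ 2 =
      ∑ x' ∈ S, ∑ x'' ∈ S, (if h k x' = h k x ∧ h k x'' = h k x then 1 else 0) := by
    intro k
    rw [sameHash, ← hS, Finset.card_filter, sq, Finset.sum_mul_sum]
    refine Finset.sum_congr rfl fun x' _ => Finset.sum_congr rfl fun x'' _ => ?_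
    by_cases h1 : h k x' = h k x <;> by_cases h2 : h k x'' = h k x <;> simp [h1, h2]
  simp_rw [hsq]
  rw [Finset.sum_comm, Finset.sum_mul]
  -- for each `x'`, split the inner sum into the diagonal and the rest
  have hinner : ∀ x' ∈ S, (∑ k, ∑ x'' ∈ S, (if h k x' = h k x ∧ h k x'' = h k x then 1 else 0)) * Fintype.card γ ^ 2 =
      (S.card - 1) * Fintype.card κ + Fintype.card κ * Fintype.card γ := by
    intro x' hx'
    rw [Finset.sum_comm, ← Finset.sum_erase_add S _ hx', add_mul, Finset.sum_mul]
    have hx'S := hx'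
    rw [hS, Finset.mem_erase] at hx'
    congr 1
    · -- off-diagonal: three distinct points
      have hterm : ∀ x'' ∈ S.erase x', (∑ k, (if h k x' = h k x ∧ h k x'' = h k x then 1 else 0)) * Fintype.card γ ^ 2 =
          Fintype.card κ := by
        intro x'' hx''
        rw [Finset.mem_erase, hS, Finset.mem_erase] at hx''
        have h3 := hK3.card_collide_two hx hx'.2 hx''.2.2 (Ne.symm hx'.1) (Ne.symm hx''.2.1) (Ne.symm hx''.1)
        rw [Finset.card_univ, Finset.card_filter] at h3
        exact h3
      rw [Finset.sum_congr rfl hterm, Finset.sum_const, smul_eq_mul, Finset.card_erase_of_mem hx'S, mul_comm]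
    · -- diagonal: `1[h x' = h x]`
      have hdiag : (∑ k, (if h k x' = h k x ∧ h k x' = h k x then 1 else 0)) =
          ((univ : Finset κ).filter fun k => h k x' = h k x).card := by
        rw [Finset.card_filter]
        refine Finset.sum_congr rfl fun k _ => ?_
        simp only [and_self]
      rw [hdiag, sq, ← mul_assoc]
      have := hK2.card_collide hx'.2 hx hx'.1
      rw [Finset.card_univ] at this
      rw [this]
  rw [Finset.sum_congr rfl hinner, Finset.sum_const, smul_eq_mul, hScard]
  have hS1 : (fiber univ F (F x)).card - 1 - 1 = (fiber univ F (F x)).card - 2 := by omega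
  rw [hS1]
  ring

/-- **Lemma 5.4 (i), counted form** (HHRVW 2020; here via Chebyshev under three-wise independence): for
an input `x` whose fibre has `N = |F⁻¹(F x)| ≥ 1` elements, the keys `k` under which fewer than half the
expected number of fibre elements share `x`'s hash value — `2 |γ| · Y(x,k) ≤ N − 1`, where
`E[Y] = (N−1)/|γ|` — number at most `4 |γ| |κ| / (N − 1)`:
`#{k : 2|γ| Y(x,k) ≤ N−1} · (N−1) ≤ 4 |γ| |κ|`. Hence after hashing `ℓ = log₂|γ|` input bits the real
min-entropy drops from `log₂ N` to at least `log₂ N − ℓ − 1`, except with probability `4 · 2^ℓ / (N−1)`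
over the key. (The printed argument fixes `g` and divides probabilities; the second-moment route is what
three-wise independence of the constructible family actually supports.) [cite: HaitnerEtAl2020, Lemma 5.4 (i)] -/
theorem card_sameHash_small_mul_le (F : α → β) {h : κ → α → γ} (x : α)
    (hK2 : IsPairwiseIndep (univ : Finset κ) h (fiber univ F (F x)))
    (hK3 : IsThreewiseIndep (univ : Finset κ) h (fiber univ F (F x))) :
    ((univ : Finset κ).filter fun k => 2 * Fintype.card γ * (sameHash F h x k).card ≤
        (fiber univ F (F x)).card - 1).card * ((fiber univ F (F x)).card - 1) ≤
      4 * Fintype.card γ * Fintype.card κ := by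
  classical
  set N1 := (fiber univ F (F x)).card - 1 with hN1
  set R := Fintype.card γ with hR
  set E := (univ : Finset κ).filter fun k => 2 * R * (sameHash F h x k).card ≤ N1 with hE
  -- degenerate cases
  rcases Nat.eq_zero_or_pos N1 with h0 | hN1pos
  · rw [h0, mul_zero]; exact Nat.zero_le _
  rcases isEmpty_or_nonempty κ with hκ | hκ
  · have : E = ∅ := Finset.eq_empty_of_forall_notMem fun k _ => hκ.elim k
    rw [this, Finset.card_empty, zero_mul]; exact Nat.zero_le _
  -- the two moments
  have hm1 := sum_card_sameHash_mul F x hK2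
  have hm2 := sum_card_sameHash_sq_mul F x hK2 hK3
  rw [← hN1, ← hR] at hm1 hm2
  have hm1Z : (∑ k, ((sameHash F h x k).card : ℤ)) * R = (N1 : ℤ) * Fintype.card κ := by exact_mod_cast hm1
  have hsub : (((fiber univ F (F x)).card - 2 : ℕ) : ℤ) = (N1 : ℤ) - 1 := by
    have : (fiber univ F (F x)).card - 2 = N1 - 1 := by rw [hN1]; omega
    rw [this]; push_cast [Nat.one_le_iff_ne_zero.2 hN1pos.ne']; ring
  have hm2Z : (∑ k, ((sameHash F h x k).card : ℤ) ^ 2) * R ^ 2 =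
      (N1 : ℤ) * Fintype.card κ * R + (N1 : ℤ) * ((N1 : ℤ) - 1) * Fintype.card κ := by
    rw [← hsub]; exact_mod_cast hm2
  -- the centred second moment: `Σ_k (R·Y_k − N1)² = N1 |κ| (R − 1)`
  have hcent : ∑ k, ((R : ℤ) * (sameHash F h x k).card - N1) ^ 2 = (N1 : ℤ) * Fintype.card κ * (R - 1) := by
    have e1 : ∑ k, ((R : ℤ) * (sameHash F h x k).card - N1) ^ 2 =
        (R : ℤ) ^ 2 * ∑ k, ((sameHash F h x k).card : ℤ) ^ 2 - 2 * R * N1 * ∑ k, ((sameHash F h x k).card : ℤ) +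
          Fintype.card κ * (N1 : ℤ) ^ 2 := by
      have : ∀ k, ((R : ℤ) * (sameHash F h x k).card - N1) ^ 2 =
          (R : ℤ) ^ 2 * ((sameHash F h x k).card : ℤ) ^ 2 - 2 * R * N1 * ((sameHash F h x k).card : ℤ) + (N1 : ℤ) ^ 2 :=
        fun k => by ring
      simp only [this, Finset.sum_add_distrib, Finset.sum_sub_distrib, ← Finset.mul_sum, Finset.sum_const,
        Finset.card_univ]
      ring
    rw [e1]
    nlinarith [hm1Z, hm2Z]
  -- Chebyshev, counted: on `E` each summand is at least `N1²/4`
  have hElow : (E.card : ℤ) * (N1 : ℤ) ^ 2 ≤ 4 * ((N1 : ℤ) * Fintype.card κ * (R - 1)) := by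
    calc (E.card : ℤ) * (N1 : ℤ) ^ 2 = ∑ k ∈ E, (N1 : ℤ) ^ 2 := by
          rw [Finset.sum_const, nsmul_eq_mul]
      _ ≤ ∑ k ∈ E, 4 * ((R : ℤ) * (sameHash F h x k).card - N1) ^ 2 := by
          refine Finset.sum_le_sum fun k hk => ?_
          rw [hE, Finset.mem_filter] at hk
          have h2a : 2 * ((R : ℤ) * (sameHash F h x k).card) ≤ N1 := by exact_mod_cast (by linarith [hk.2] : 2 * (R * (sameHash F h x k).card) ≤ N1)
          have ha0 : 0 ≤ (R : ℤ) * (sameHash F h x k).card := by positivity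
          nlinarith [mul_nonneg (sub_nonneg.2 h2a) (by linarith : (0 : ℤ) ≤ 3 * N1 - 2 * ((R : ℤ) * (sameHash F h x k).card))]
      _ ≤ ∑ k, 4 * ((R : ℤ) * (sameHash F h x k).card - N1) ^ 2 :=
          Finset.sum_le_sum_of_subset_of_nonneg (Finset.subset_univ E) fun k _ _ => by positivity
      _ = 4 * ((N1 : ℤ) * Fintype.card κ * (R - 1)) := by rw [← Finset.mul_sum, hcent]
  -- divide by `N1 > 0` and drop the `−1`
  have hN1Z : (0 : ℤ) < N1 := by exact_mod_cast hN1pos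
  have hK0 : (0 : ℤ) ≤ Fintype.card κ := by positivity
  have hfin : (E.card : ℤ) * N1 ≤ 4 * R * Fintype.card κ := by
    have h1 : (E.card : ℤ) * N1 ≤ 4 * (Fintype.card κ * ((R : ℤ) - 1)) := by
      have := hElow
      nlinarith
    nlinarith
  exact_mod_cast hfin

end HashInputReal

/-! ### Union bounds under pairwise independence (Lemmas 5.4 (ii) and 5.5) -/

section UnionBound

variable [Fintype α] [Fintype κ] [DecidableEq γ] [Fintype γ] {δ : Type*} [DecidableEq δ]

/-- **Union bound for designated collisions.** For a family `h` pairwise independent on a set `S ⊆ δ`,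
points `pt a ∈ S` and candidate sets `T a ⊆ S`: the pairs `(a, k)` for which some `y ∈ T a` other than
`pt a` collides with `pt a` under `h_k` number at most `(Σ_a |T a|) · |κ| / |γ|` (stated multiplied out).
This is the counting step of both Lemma 5.4 (ii) (`T a = L(a)`, Eq. (5.4)) and Lemma 5.5 (`T a = Im(F)`,
Eq. (5.7)). [cite: HaitnerEtAl2020, Lemma 5.4 (ii) and Lemma 5.5 (proofs)] -/
theorem card_exists_collide_mul_le {h : κ → δ → γ} {S : Finset δ} (hK : IsPairwiseIndep (univ : Finset κ) h S)
    (pt : α → δ) (hpt : ∀ a, pt a ∈ S) (T : α → Finset δ) (hT : ∀ a, T a ⊆ S) :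
    ((univ : Finset (α × κ)).filter fun p => ∃ y ∈ T p.1, y ≠ pt p.1 ∧ h p.2 y = h p.2 (pt p.1)).card *
        Fintype.card γ ≤ (∑ a, (T a).card) * Fintype.card κ := by
  classical
  -- fibrewise over `a`
  have hsplit : ((univ : Finset (α × κ)).filter fun p => ∃ y ∈ T p.1, y ≠ pt p.1 ∧ h p.2 y = h p.2 (pt p.1)).card =
      ∑ a, ((univ : Finset κ).filter fun k => ∃ y ∈ T a, y ≠ pt a ∧ h k y = h k (pt a)).card := by
    rw [Finset.card_filter, Fintype.sum_prod_type]
    refine Finset.sum_congr rfl fun a _ => ?_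
    rw [Finset.card_filter]
  rw [hsplit, Finset.sum_mul, Finset.sum_mul]
  refine Finset.sum_le_sum fun a _ => ?_
  -- union bound over the witnesses `y ∈ T a ∖ {pt a}`
  have hsub : ((univ : Finset κ).filter fun k => ∃ y ∈ T a, y ≠ pt a ∧ h k y = h k (pt a)) ⊆
      ((T a).erase (pt a)).biUnion fun y => (univ : Finset κ).filter fun k => h k y = h k (pt a) := by
    intro k hk
    rw [Finset.mem_filter] at hk
    obtain ⟨y, hy, hne, hcol⟩ := hk.2
    rw [Finset.mem_biUnion]
    exact ⟨y, Finset.mem_erase.2 ⟨hne, hy⟩, Finset.mem_filter.2 ⟨Finset.mem_univ _, hcol⟩⟩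
  calc ((univ : Finset κ).filter fun k => ∃ y ∈ T a, y ≠ pt a ∧ h k y = h k (pt a)).card * Fintype.card γ
      ≤ (∑ y ∈ (T a).erase (pt a), ((univ : Finset κ).filter fun k => h k y = h k (pt a)).card) * Fintype.card γ :=
        Nat.mul_le_mul_right _ ((Finset.card_le_card hsub).trans Finset.card_biUnion_le)
    _ = ∑ y ∈ (T a).erase (pt a), Fintype.card κ := by
        rw [Finset.sum_mul]
        refine Finset.sum_congr rfl fun y hy => ?_
        rw [Finset.mem_erase] at hy
        have := hK.card_collide ((hT a) hy.2) (hpt a) hy.1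
        rwa [Finset.card_univ] at this
    _ ≤ (T a).card * Fintype.card κ := by
        rw [Finset.sum_const, smul_eq_mul]
        exact Nat.mul_le_mul_right _ (Finset.card_erase_le)

end UnionBound

/-! ### Lemma 5.4 (ii): hashing the input turns accessible max-entropy `0 + slack` into collision resistance -/

section HashInputAcc

variable [Fintype α] [DecidableEq α] [Fintype κ] [DecidableEq κ] [DecidableEq γ] {Ω : Type*} [Fintype Ω]

/-- **Lemma 5.4 (ii), the reduction count** (HHRVW 2020). Let `A'` be an `F'`-collision finder for
`F'(a, k) = (F a, k, h_k a)` — so its output keeps the key and the hash value (`hA2`, `hAh`) — and let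
`A(a; k, r) = A'(a, k; r).1` be the induced finder for `F` (a uniformly chosen key as extra coins). Then
`#{A' moves} ≤ #{A escapes L} + |Ω| · #{(a, k) : some a' ∈ L(a) ∖ {a} has h_k a' = h_k a}`:
an answer `(a', k) ≠ (a, k)` has `a' ≠ a`, and either `a' ∉ L(a)` or `a'` is a designated collision
inside `L(a)`. [cite: HaitnerEtAl2020, Lemma 5.4 (ii), Eq. (5.2)–(5.5)] -/
theorem card_move_le_card_escape_add {h : κ → α → γ} (L : α → Finset α)
    (A' : α → κ → Ω → α × κ) (hA2 : ∀ a k r, (A' a k r).2 = k) (hAh : ∀ a k r, h k (A' a k r).1 = h k a) :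
    ((univ : Finset (α × κ × Ω)).filter fun q => A' q.1 q.2.1 q.2.2 ≠ (q.1, q.2.1)).card ≤
      ((univ : Finset (α × κ × Ω)).filter fun q => (A' q.1 q.2.1 q.2.2).1 ∉ L q.1).card +
        Fintype.card Ω * ((univ : Finset (α × κ)).filter
          fun p => ∃ a' ∈ L p.1, a' ≠ p.1 ∧ h p.2 a' = h p.2 p.1).card := by
  classical
  -- the second summand as a count over triples
  have hΩ : Fintype.card Ω * ((univ : Finset (α × κ)).filter
        fun p => ∃ a' ∈ L p.1, a' ≠ p.1 ∧ h p.2 a' = h p.2 p.1).card =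
      ((univ : Finset (α × κ × Ω)).filter fun q => ∃ a' ∈ L q.1, a' ≠ q.1 ∧ h q.2.1 a' = h q.2.1 q.1).card := by
    have hset : ((univ : Finset (α × κ × Ω)).filter fun q => ∃ a' ∈ L q.1, a' ≠ q.1 ∧ h q.2.1 a' = h q.2.1 q.1) =
        ((((univ : Finset (α × κ)).filter fun p => ∃ a' ∈ L p.1, a' ≠ p.1 ∧ h p.2 a' = h p.2 p.1) ×ˢ
          (univ : Finset Ω)).map (Equiv.prodAssoc α κ Ω).toEmbedding) := by
      ext ⟨a, k, r⟩
      simp [Equiv.prodAssoc]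
    rw [hset, Finset.card_map, Finset.card_product, Finset.card_univ, mul_comm]
  rw [hΩ]
  refine le_trans (Finset.card_le_card fun q hq => ?_) (Finset.card_union_le _ _)
  rw [Finset.mem_filter] at hq
  rw [Finset.mem_union, Finset.mem_filter, Finset.mem_filter]
  obtain ⟨a, k, r⟩ := q
  simp only at hq ⊢
  have hne : (A' a k r).1 ≠ a := by
    intro h1
    apply hq.2
    exact Prod.ext h1 (hA2 a k r)
  by_cases hL : (A' a k r).1 ∈ L a
  · right
    exact ⟨Finset.mem_univ _, (A' a k r).1, hL, hne, hAh a k r⟩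
  · left
    exact ⟨Finset.mem_univ _, hL⟩

end HashInputAcc

/-! ### Lemma 5.5: hashing the output of a function with real min-entropy -/

section HashOutput

variable [Fintype α] [DecidableEq β] [Fintype κ] [DecidableEq γ] [Fintype γ]

/-- **Few images under real min-entropy** (Eq. (5.6)): if all but the inputs in a "light" set have fibres
of size at least `Nmin`, then `|Im F| · Nmin ≤ #{light inputs} · Nmin + |α|` (light images are at most as
many as light inputs; each heavy image absorbs `Nmin` inputs). [cite: HaitnerEtAl2020, Lemma 5.5, Eq. (5.6)] -/
theorem card_image_mul_le (F : α → β) (Nmin : ℕ) :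
    (univ.image F).card * Nmin ≤
      ((univ : Finset α).filter fun a => (fiber univ F (F a)).card < Nmin).card * Nmin + Fintype.card α := by
  classical
  set Img := (univ : Finset α).image F with hImg
  set light := Img.filter fun y => (fiber univ F y).card < Nmin with hlight
  set heavy := Img.filter fun y => ¬ (fiber univ F y).card < Nmin with hheavy
  have hsplit : Img.card = light.card + heavy.card := (Finset.card_filter_add_card_filter_not _).symm
  -- light images are at most as many as light inputs (`F` maps the latter onto the former)
  have h1 : light.card ≤ ((univ : Finset α).filter fun a => (fiber univ F (F a)).card < Nmin).card := by
    refine Finset.card_le_card_of_surjOn F fun y hy => ?_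
    rw [hlight, Finset.coe_filter, Set.mem_setOf_eq, hImg, Finset.mem_image] at hy
    obtain ⟨⟨a, -, rfl⟩, hlt⟩ := hy
    exact ⟨a, by rw [Finset.coe_filter]; exact ⟨Finset.mem_univ _, hlt⟩, rfl⟩
  -- heavy images absorb `Nmin` inputs each
  have h2 : heavy.card * Nmin ≤ Fintype.card α := by
    have htot : Fintype.card α = ∑ y ∈ Img, (fiber univ F y).card := by
      rw [← Finset.card_univ]
      exact Finset.card_eq_sum_card_fiberwise fun a _ => Finset.mem_image_of_mem F (Finset.mem_univ a)
    calc heavy.card * Nmin = ∑ y ∈ heavy, Nmin := by rw [Finset.sum_const, smul_eq_mul]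
      _ ≤ ∑ y ∈ heavy, (fiber univ F y).card := Finset.sum_le_sum fun y hy => by
          rw [hheavy, Finset.mem_filter] at hy; exact not_lt.1 hy.2
      _ ≤ ∑ y ∈ Img, (fiber univ F y).card :=
          Finset.sum_le_sum_of_subset_of_nonneg (Finset.filter_subset _ _) fun _ _ _ => Nat.zero_le _
      _ = Fintype.card α := htot.symm
  calc Img.card * Nmin = light.card * Nmin + heavy.card * Nmin := by rw [hsplit, add_mul]
    _ ≤ _ := Nat.add_le_add (Nat.mul_le_mul_right _ h1) h2

/-- **Lemma 5.5, the collision count** (Eq. (5.7)): for an output hash `h` pairwise independent on a set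
`Img` containing the image of `F`, the pairs `(a, k)` admitting some `y' ∈ Img`, `y' ≠ F a`, with
`h_k y' = h_k (F a)` number at most `|α| · |Img| · |κ| / |γ|`. [cite: HaitnerEtAl2020, Lemma 5.5, Eq. (5.7)] -/
theorem card_exists_image_collide_mul_le (F : α → β) {Img : Finset β} (hImg : ∀ a, F a ∈ Img) {h : κ → β → γ}
    (hK : IsPairwiseIndep (univ : Finset κ) h Img) :
    ((univ : Finset (α × κ)).filter fun p : α × κ =>
        ∃ y' ∈ Img, y' ≠ F p.1 ∧ h p.2 y' = h p.2 (F p.1)).card *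
        Fintype.card γ ≤ Fintype.card α * Img.card * Fintype.card κ := by
  have := card_exists_collide_mul_le hK F hImg (fun _ => Img) (fun _ => le_refl _)
  rwa [Finset.sum_const, Finset.card_univ, smul_eq_mul] at this

variable [DecidableEq α] [DecidableEq κ] {Ω : Type*} [Fintype Ω]

omit [Fintype γ] in
/-- **Lemma 5.5, the reduction count.** Let `A''` be a collision finder for `F'(a, k) = (k, h_k(F a))`
(`hA2`: it keeps the key; `hAh`: its answer has the same hashed image) and let `A(a; k, r)` output
`A''(a, k; r).1` when that is an `F`-sibling of `a` and `a` otherwise. Then, for any `Img ⊇ Im F`,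
`#{A'' moves} ≤ #{A finds an F-collision on a random input} + |Ω| · #{(a,k) : some y' ∈ Img, y' ≠ F a, has h_k y' = h_k (F a)}`.
[cite: HaitnerEtAl2020, Lemma 5.5 (proof, "a collision for g ∘ F is also a collision for F")] -/
theorem card_move_le_card_collision_add (F : α → β) {Img : Finset β} (hImg : ∀ a, F a ∈ Img) {h : κ → β → γ}
    (A'' : α → κ → Ω → α × κ) (hA2 : ∀ a k r, (A'' a k r).2 = k) (hAh : ∀ a k r, h k (F (A'' a k r).1) = h k (F a)) :
    ((univ : Finset (α × κ × Ω)).filter fun q => A'' q.1 q.2.1 q.2.2 ≠ (q.1, q.2.1)).card ≤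
      ((univ : Finset (α × κ × Ω)).filter fun q => (A'' q.1 q.2.1 q.2.2).1 ≠ q.1 ∧ F (A'' q.1 q.2.1 q.2.2).1 = F q.1).card +
        Fintype.card Ω * ((univ : Finset (α × κ)).filter
          fun p : α × κ => ∃ y' ∈ Img, y' ≠ F p.1 ∧ h p.2 y' = h p.2 (F p.1)).card := by
  classical
  have hΩ : Fintype.card Ω * ((univ : Finset (α × κ)).filter
        fun p : α × κ => ∃ y' ∈ Img, y' ≠ F p.1 ∧ h p.2 y' = h p.2 (F p.1)).card =
      ((univ : Finset (α × κ × Ω)).filter fun q => ∃ y' ∈ Img, y' ≠ F q.1 ∧ h q.2.1 y' = h q.2.1 (F q.1)).card := by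
    have hset : ((univ : Finset (α × κ × Ω)).filter fun q => ∃ y' ∈ Img, y' ≠ F q.1 ∧ h q.2.1 y' = h q.2.1 (F q.1)) =
        ((((univ : Finset (α × κ)).filter fun p : α × κ =>
            ∃ y' ∈ Img, y' ≠ F p.1 ∧ h p.2 y' = h p.2 (F p.1)) ×ˢ
          (univ : Finset Ω)).map (Equiv.prodAssoc α κ Ω).toEmbedding) := by
      ext ⟨a, k, r⟩
      simp [Equiv.prodAssoc]
    rw [hset, Finset.card_map, Finset.card_product, Finset.card_univ, mul_comm]
  rw [hΩ]
  refine le_trans (Finset.card_le_card fun q hq => ?_) (Finset.card_union_le _ _)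
  rw [Finset.mem_filter] at hq
  rw [Finset.mem_union, Finset.mem_filter, Finset.mem_filter]
  obtain ⟨a, k, r⟩ := q
  simp only at hq ⊢
  have hne : (A'' a k r).1 ≠ a := by
    intro h1
    apply hq.2
    exact Prod.ext h1 (hA2 a k r)
  by_cases hF : F (A'' a k r).1 = F a
  · left
    exact ⟨Finset.mem_univ _, hne, hF⟩
  · right
    exact ⟨Finset.mem_univ _, F (A'' a k r).1, hImg _, hF, hAh a k r⟩

end HashOutput

/-! ### Lemma 5.6: from collision resistance on random inputs to target collision resistance by a random shift -/

section Shift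

variable [Fintype α] [DecidableEq α] [AddCommGroup α] [DecidableEq β] {P Ω : Type*} [Fintype P] [Fintype Ω]

/-- **Lemma 5.6, counted form** (folklore; HHRVW 2020). For the shifted family `F_y(x) = F(y + x)` and a
two-stage target-collision adversary — first stage `x₀(ρ)` from coins `ρ`, second stage `A(y, ρ; r)` given the
key `y` and the first-stage coins — the collision finder on a random input `x`,
`B(x; ρ, r) = (x − x₀(ρ)) + A(x − x₀(ρ), ρ; r)`, finds a collision `B(x) ≠ x`, `F(B x) = F x` for exactly as
many `(x, ρ, r)` as there are `(y, ρ, r)` on which the adversary forms a designated collision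
(`A ≠ x₀` and `F(y + A) = F(y + x₀)`): the substitution `y = x − x₀(ρ)` is a bijection.
[cite: HaitnerEtAl2020, Lemma 5.6] -/
theorem card_shift_collision_eq (F : α → β) (x₀ : P → α) (A : α → P → Ω → α) :
    ((univ : Finset (α × P × Ω)).filter fun q =>
        (q.1 - x₀ q.2.1) + A (q.1 - x₀ q.2.1) q.2.1 q.2.2 ≠ q.1 ∧
          F ((q.1 - x₀ q.2.1) + A (q.1 - x₀ q.2.1) q.2.1 q.2.2) = F q.1).card =
      ((univ : Finset (α × P × Ω)).filter fun q =>
        A q.1 q.2.1 q.2.2 ≠ x₀ q.2.1 ∧ F (q.1 + A q.1 q.2.1 q.2.2) = F (q.1 + x₀ q.2.1)).card := by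
  classical
  -- the shift `(x, ρ, r) ↦ (x − x₀ ρ, ρ, r)`
  set e : α × P × Ω ≃ α × P × Ω :=
    { toFun := fun q => (q.1 - x₀ q.2.1, q.2.1, q.2.2)
      invFun := fun q => (q.1 + x₀ q.2.1, q.2.1, q.2.2)
      left_inv := fun q => by rcases q with ⟨x, ρ, r⟩; simp
      right_inv := fun q => by rcases q with ⟨y, ρ, r⟩; simp } with he
  have hset : ((univ : Finset (α × P × Ω)).filter fun q =>
        (q.1 - x₀ q.2.1) + A (q.1 - x₀ q.2.1) q.2.1 q.2.2 ≠ q.1 ∧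
          F ((q.1 - x₀ q.2.1) + A (q.1 - x₀ q.2.1) q.2.1 q.2.2) = F q.1) =
      (((univ : Finset (α × P × Ω)).filter fun q =>
        A q.1 q.2.1 q.2.2 ≠ x₀ q.2.1 ∧ F (q.1 + A q.1 q.2.1 q.2.2) = F (q.1 + x₀ q.2.1)).map e.symm.toEmbedding) := by
    ext ⟨x, ρ, r⟩
    simp only [Finset.mem_filter, Finset.mem_univ, true_and, Finset.mem_map_equiv, Equiv.symm_symm, he,
      Equiv.coe_fn_mk]
    have hx : x - x₀ ρ + x₀ ρ = x := sub_add_cancel x (x₀ ρ)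
    constructor
    · rintro ⟨hne, hF⟩
      refine ⟨fun hA => hne ?_, by rw [hx]; exact hF⟩
      rw [hA, hx]
    · rintro ⟨hne, hF⟩
      refine ⟨fun hEq => hne ?_, by rw [hx] at hF; exact hF⟩
      have := congrArg (fun z => z - (x - x₀ ρ)) hEq
      simp only [add_sub_cancel_left] at this
      rw [this]; abel
  rw [hset, Finset.card_map]

end Shift

end HHRVW

end Literature.Computability.Cryptography
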